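import Literature.NumberTheory.Automorphic.MeyerDifferenceRepresentation
import HarnessLib

/-!
# A level criterion for membership in the adelic Schwartz–Bruhat space `𝒮(𝔸_K^ι)` / `𝒮(𝔸_K)`

Topic `NumberTheory/Automorphic`; namespace `Literature.NumberTheory.Automorphic`. THEOREMS ONLY over accepted
tree modules (★ `AdelicPiSchwartzBruhatFourier`: `piSchwartzBruhat K ι = span {Φ_∞ ⊗ Φ_f}`; ★
`MeyerDifferenceRepresentation`: `Meyer.schwartzBruhatAdele K`): no definition, no named fact, no instance, no
notation, no `sorry`.

THE POINT (Weil, *Basic Number Theory*, Ch. VII §2, Def. 2 and Prop. 2; Tate (1967), §3.2, §4.2: a «standard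
function» on `𝔸_K^ι` is a finite linear combination of products `Φ_∞ ⊗ 𝟙_{y + L}`). The tree DEFINES
`𝒮(𝔸_K^ι)` as the span of pure tensors; analytic constructions (averages, integrals along unipotent groups)
produce instead a function `Φ` with THREE PROPERTIES: (1) finite support — the finite coordinates of the support
lie in a compact set `C ⊆ (𝔸_K^∞)^ι`; (2) a finite LEVEL — `Φ` is invariant under translation of the finite
coordinates by a compact open subgroup `L`; (3) archimedean regularity — every slice `x_∞ ↦ Φ(x_∞, y)` is smooth
of compact support. **`mem_piSchwartzBruhat_of_level`**: (1)+(2)+(3) ⇒ `Φ ∈ 𝒮(𝔸_K^ι)`. Proof: the image of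
`C` in the discrete quotient `(𝔸_K^∞)^ι ⧸ L` is finite, so `Φ = Σ_{q} Φ(·, q̃) ⊗ 𝟙_{π⁻¹ q}` is a finite sum of
pure tensors (`HasCompactSupport.toSchwartzMap` for the slices; the fibres `π⁻¹ q` are compact open, so their
indicators are locally constant of compact support). **`Meyer.mem_schwartzBruhatAdele_of_level`** is the
one-variable corollary for `𝒮(𝔸_K)` in the letters of ★ `Meyer.schwartzBruhatAdele` (`f : 𝔸_K → ℂ`, slices
`x ↦ f ((K_∞ ≃ K ⊗ ℝ)⁻¹ x, y)`). Consumers: the Heisenberg `K`-average of a test function on `U(J₃)(𝔸)`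
(row (L5-i)(E3-pre) of `Cruxes/H413/Lines/F0_T1InnerFormTraceIdentity.lean`, cell `pub/hodgecm-mathlib`).

* §1 `isCompact_preimage_addMk_singleton`, `isOpen_preimage_addMk_singleton`, `indicator_preimage_addMk_mem_schwartzBruhat`
  — the fibres of `(𝔸_K^∞)^ι → (𝔸_K^∞)^ι ⧸ L` over a compact open subgroup `L` and their indicators;
  `finite_image_addMk_of_isCompact` — a compact set meets finitely many `L`-cosets.
* §2 **`mem_piSchwartzBruhat_of_level`** (and the pointwise decomposition `eq_sum_slice_mul_indicator_of_level`).
* §3 **`Meyer.mem_schwartzBruhatAdele_of_level`**.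

## References

* A. Weil, *Basic Number Theory*, Grundlehren 144 (1967), Ch. VII §2 [WeilBNT1967].
* J. Tate, *Fourier analysis in number fields and Hecke's zeta-functions* (1967), §3.2, §4.2
  [CasselsFrohlichANT1967].
* R. Meyer, *On a representation of the idele class group related to primes and zeros of L-functions*,
  Duke Math. J. 127 (2005), §1 p. 4, §5.1 [Meyer2005].
-/

set_option autoImplicit false

noncomputable section

open NumberField NumberField.mixedEmbedding IsDedekindDomain Set Topology
-- `Classical` is needed to see the Mathlib normed-space instances on `mixedSpace K` (note H5 of `AdelicGLnGlue`)
open scoped SchwartzMap ContDiff Classical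

namespace Literature.NumberTheory.Automorphic

variable {K : Type} [Field K] [NumberField K] {ι : Type}

/-! ## §1 Fibres of the quotient by a compact open subgroup of `(𝔸_K^∞)^ι` -/

section Fibres

variable {X : Type*} [AddCommGroup X] [TopologicalSpace X] [IsTopologicalAddGroup X]

omit [TopologicalSpace X] [IsTopologicalAddGroup X] in
/-- A fibre `π⁻¹{q}` of `X → X ⧸ L` is the translate `q̃ + L` of `L` by any lift: `z ∈ π⁻¹{q} ↔ -q̃ + z ∈ L`.
[cite: WeilBNT1967, Ch. VII §2] -/
theorem mem_preimage_addMk_singleton_iff (L : AddSubgroup X) (q : X ⧸ L) (z : X) :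
    z ∈ (QuotientAddGroup.mk : X → X ⧸ L) ⁻¹' {q} ↔ -q.out + z ∈ L := by
  rw [mem_preimage, mem_singleton_iff, ← QuotientAddGroup.out_eq' q, QuotientAddGroup.out_eq', eq_comm]
  conv_lhs => rw [← QuotientAddGroup.out_eq' q]
  exact QuotientAddGroup.eq

/-- The fibres of `X → X ⧸ L` over a COMPACT subgroup are compact (`π⁻¹{q} = q̃ + L`). [cite: WeilBNT1967, Ch. VII §2] -/
theorem isCompact_preimage_addMk_singleton {L : AddSubgroup X} (hLc : IsCompact (L : Set X)) (q : X ⧸ L) :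
    IsCompact ((QuotientAddGroup.mk : X → X ⧸ L) ⁻¹' {q}) := by
  have h : (QuotientAddGroup.mk : X → X ⧸ L) ⁻¹' {q} = (fun l : X => q.out + l) '' (L : Set X) := by
    ext z
    rw [mem_preimage_addMk_singleton_iff]
    constructor
    · intro hz
      exact ⟨-q.out + z, hz, by show q.out + (-q.out + z) = z; rw [← add_assoc, add_neg_cancel, zero_add]⟩
    · rintro ⟨l, hl, rfl⟩
      show -q.out + (q.out + l) ∈ L
      rwa [← add_assoc, neg_add_cancel, zero_add]
  rw [h]
  exact hLc.image (continuous_const.add continuous_id)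

omit [IsTopologicalAddGroup X] in
/-- The fibres of `X → X ⧸ L` over an OPEN subgroup are open (the quotient is discrete). [cite: WeilBNT1967, Ch. VII §2] -/
theorem isOpen_preimage_addMk_singleton [ContinuousAdd X] {L : AddSubgroup X} (hLo : IsOpen (L : Set X)) (q : X ⧸ L) :
    IsOpen ((QuotientAddGroup.mk : X → X ⧸ L) ⁻¹' {q}) := by
  haveI : DiscreteTopology (X ⧸ L) := QuotientAddGroup.discreteTopology hLo
  exact (isOpen_discrete {q}).preimage QuotientAddGroup.continuous_mk

omit [IsTopologicalAddGroup X] in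
/-- **A compact set meets finitely many cosets of an open subgroup**: the image of a compact `C` in the discrete
quotient `X ⧸ L` is finite. [cite: WeilBNT1967, Ch. VII §2] -/
theorem finite_image_addMk_of_isCompact [ContinuousAdd X] {L : AddSubgroup X} (hLo : IsOpen (L : Set X)) {C : Set X}
    (hCc : IsCompact C) : ((QuotientAddGroup.mk : X → X ⧸ L) '' C).Finite := by
  haveI : DiscreteTopology (X ⧸ L) := QuotientAddGroup.discreteTopology hLo
  exact (hCc.image (QuotientAddGroup.continuous_mk (N := L))).finite_of_discrete

/-- **The indicator of a fibre `π⁻¹{q}` of a compact open subgroup is a (finite) Schwartz–Bruhat function**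
(locally constant, as the fibre is clopen, and compactly supported). [cite: WeilBNT1967, Ch. VII §2] -/
theorem indicator_preimage_addMk_mem_schwartzBruhat [T2Space X] {L : AddSubgroup X} (hLo : IsOpen (L : Set X))
    (hLc : IsCompact (L : Set X)) (q : X ⧸ L) :
    ((QuotientAddGroup.mk : X → X ⧸ L) ⁻¹' {q}).indicator (1 : X → ℂ) ∈ SchwartzBruhat X := by
  set S := (QuotientAddGroup.mk : X → X ⧸ L) ⁻¹' {q} with hS
  have hSo : IsOpen S := isOpen_preimage_addMk_singleton hLo q
  have hSc : IsCompact S := isCompact_preimage_addMk_singleton hLc q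
  refine (mem_schwartzBruhat_iff).2 ⟨?_, ?_⟩
  · refine (IsLocallyConstant.iff_exists_open _).mpr fun y => ?_
    by_cases hy : y ∈ S
    · exact ⟨S, hSo, hy, fun y' hy' => by rw [indicator_of_mem hy', indicator_of_mem hy]; rfl⟩
    · exact ⟨Sᶜ, hSc.isClosed.isOpen_compl, hy, fun y' hy' => by
        rw [indicator_of_notMem (show y' ∉ S from hy'), indicator_of_notMem hy]⟩
  · exact HasCompactSupport.of_support_subset_isCompact hSc fun y hy => by
      by_contra hyS
      exact hy (indicator_of_notMem hyS _)

end Fibres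

/-! ## §2 The level criterion on `𝔸_K^ι` -/

section Criterion

/-- `(𝔸_K^∞)^ι` is Hausdorff (restricted product). [folklore] -/
private theorem t2Space_piFiniteAdele' : T2Space (ι → FiniteAdeleRing (𝓞 K) K) := by
  haveI : T2Space (FiniteAdeleRing (𝓞 K) K) := inferInstanceAs <| T2Space
    (RestrictedProduct (fun w : IsDedekindDomain.HeightOneSpectrum (𝓞 K) => w.adicCompletion K)
      (fun w => (w.adicCompletionIntegers K : Set (w.adicCompletion K))) Filter.cofinite)
  infer_instance

/-- **POINTWISE DECOMPOSITION along a level.** If the finite coordinates of the support of `Φ` lie in `C`, and `Φ` is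
invariant under finite translations by the subgroup `L`, then for every finite set `T` of `L`-cosets containing the
image of `C`, `Φ(v) = Σ_{q ∈ T} Φ(v_∞, q̃) · 𝟙_{π⁻¹ q}(v_f)` (`q̃ = q.out`). [cite: WeilBNT1967, Ch. VII §2, Prop. 2] -/
theorem eq_sum_slice_mul_indicator_of_level {Φ : (ι → AdeleRing (𝓞 K) K) → ℂ}
    {C : Set (ι → FiniteAdeleRing (𝓞 K) K)} (hsupp : ∀ v, Φ v ≠ 0 → piFinite K ι v ∈ C)
    {L : AddSubgroup (ι → FiniteAdeleRing (𝓞 K) K)}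
    (hinv : ∀ (x : ι → mixedSpace K) (y : ι → FiniteAdeleRing (𝓞 K) K), ∀ δ ∈ L,
      Φ (piAdeleSplit K ι (x, y + δ)) = Φ (piAdeleSplit K ι (x, y)))
    {T : Finset ((ι → FiniteAdeleRing (𝓞 K) K) ⧸ L)}
    (hT : (QuotientAddGroup.mk : _ → (ι → FiniteAdeleRing (𝓞 K) K) ⧸ L) '' C ⊆ ↑T) (v : ι → AdeleRing (𝓞 K) K) :
    Φ v = ∑ q ∈ T, Φ (piAdeleSplit K ι (piArch K ι v, q.out)) *
      ((QuotientAddGroup.mk : _ → (ι → FiniteAdeleRing (𝓞 K) K) ⧸ L) ⁻¹' {q}).indicator 1 (piFinite K ι v) := by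
  classical
  set π := (QuotientAddGroup.mk : _ → (ι → FiniteAdeleRing (𝓞 K) K) ⧸ L) with hπ
  have hv : piAdeleSplit K ι (piArch K ι v, piFinite K ι v) = v := (piAdeleSplit K ι).apply_symm_apply v
  -- the indicators as `ite`
  have hind : ∀ q : (ι → FiniteAdeleRing (𝓞 K) K) ⧸ L,
      (π ⁻¹' {q}).indicator (1 : (ι → FiniteAdeleRing (𝓞 K) K) → ℂ) (piFinite K ι v) =
        if π (piFinite K ι v) = q then 1 else 0 := fun q => by
    by_cases h : π (piFinite K ι v) = q
    · rw [if_pos h, indicator_of_mem (show piFinite K ι v ∈ π ⁻¹' {q} from h), Pi.one_apply]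
    · rw [if_neg h, indicator_of_notMem (show piFinite K ι v ∉ π ⁻¹' {q} from h)]
  simp_rw [hind, mul_ite, mul_one, mul_zero]
  rw [Finset.sum_ite_eq]
  by_cases hq : π (piFinite K ι v) ∈ T
  · rw [if_pos hq]
    obtain ⟨δ, hδ⟩ := QuotientAddGroup.mk_out_eq_mul L (piFinite K ι v)
    rw [show (π (piFinite K ι v)).out = piFinite K ι v + δ from hδ, hinv _ _ _ δ.2, hv]
  · rw [if_neg hq]
    by_contra h0
    exact hq (hT ⟨piFinite K ι v, hsupp v h0, rfl⟩)

/-- **THE LEVEL CRITERION for `𝒮(𝔸_K^ι)`.** Let `Φ : 𝔸_K^ι → ℂ` have (1) the finite coordinates of its support in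
a compact set `C`, (2) a compact open level `L ≤ (𝔸_K^∞)^ι` of translation invariance in the finite coordinates,
and (3) smooth compactly supported archimedean slices `x ↦ Φ(x, y)`. Then `Φ` is a finite sum of pure tensors
`Φ(·, q̃) ⊗ 𝟙_{π⁻¹ q}`, hence `Φ ∈ 𝒮(𝔸_K^ι)`. [cite: WeilBNT1967, Ch. VII §2, Def. 2 and Prop. 2]
[cite: CasselsFrohlichANT1967, Tate §3.2] -/
theorem mem_piSchwartzBruhat_of_level [Fintype ι] {Φ : (ι → AdeleRing (𝓞 K) K) → ℂ}
    {C : Set (ι → FiniteAdeleRing (𝓞 K) K)} (hCc : IsCompact C) (hsupp : ∀ v, Φ v ≠ 0 → piFinite K ι v ∈ C)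
    {L : AddSubgroup (ι → FiniteAdeleRing (𝓞 K) K)} (hLo : IsOpen (L : Set (ι → FiniteAdeleRing (𝓞 K) K)))
    (hLc : IsCompact (L : Set (ι → FiniteAdeleRing (𝓞 K) K)))
    (hinv : ∀ (x : ι → mixedSpace K) (y : ι → FiniteAdeleRing (𝓞 K) K), ∀ δ ∈ L,
      Φ (piAdeleSplit K ι (x, y + δ)) = Φ (piAdeleSplit K ι (x, y)))
    (hsm : ∀ y : ι → FiniteAdeleRing (𝓞 K) K, ContDiff ℝ ∞ fun x : ι → mixedSpace K => Φ (piAdeleSplit K ι (x, y)))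
    (hcs : ∀ y : ι → FiniteAdeleRing (𝓞 K) K, HasCompactSupport fun x : ι → mixedSpace K => Φ (piAdeleSplit K ι (x, y))) :
    Φ ∈ piSchwartzBruhat K ι := by
  classical
  haveI := t2Space_piFiniteAdele' (K := K) (ι := ι)
  set π := (QuotientAddGroup.mk : _ → (ι → FiniteAdeleRing (𝓞 K) K) ⧸ L) with hπ
  obtain ⟨T, hT⟩ : ∃ T : Finset ((ι → FiniteAdeleRing (𝓞 K) K) ⧸ L), π '' C ⊆ ↑T :=
    ⟨(finite_image_addMk_of_isCompact hLo hCc).toFinset, by rw [Finite.coe_toFinset]⟩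
  have hdec : Φ = ∑ q ∈ T, fun v => Φ (piAdeleSplit K ι (piArch K ι v, q.out)) * (π ⁻¹' {q}).indicator 1 (piFinite K ι v) := by
    funext v
    rw [Finset.sum_apply]
    exact eq_sum_slice_mul_indicator_of_level hsupp hinv hT v
  rw [hdec]
  refine Submodule.sum_mem _ fun q _ => ?_
  exact mem_piSchwartzBruhat ⟨(hcs q.out).toSchwartzMap (hsm q.out), (π ⁻¹' {q}).indicator 1,
    indicator_preimage_addMk_mem_schwartzBruhat hLo hLc q, rfl⟩

end Criterion

/-! ## §3 The one-variable corollary for `𝒮(𝔸_K)` -/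

section OneVariable

/-- **THE LEVEL CRITERION for `𝒮(𝔸_K)` = ★ `Meyer.schwartzBruhatAdele K`.** Let `f : 𝔸_K → ℂ` have (1) the finite
component of its support in a compact `C ⊆ 𝔸_K^∞`, (2) a compact open level `L ≤ 𝔸_K^∞` with `f(x, y + δ) = f(x, y)`
for `δ ∈ L`, and (3) smooth compactly supported archimedean slices `x ↦ f((K_∞ ≃ K ⊗ ℝ)⁻¹ x, y)` on `K ⊗ ℝ`. Then
`f ∈ 𝒮(𝔸_K)`. [cite: WeilBNT1967, Ch. VII §2, Def. 2 and Prop. 2] [cite: Meyer2005, §1 p. 4] -/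
theorem Meyer.mem_schwartzBruhatAdele_of_level {f : AdeleRing (𝓞 K) K → ℂ}
    {C : Set (FiniteAdeleRing (𝓞 K) K)} (hCc : IsCompact C) (hsupp : ∀ a, f a ≠ 0 → a.2 ∈ C)
    {L : AddSubgroup (FiniteAdeleRing (𝓞 K) K)} (hLo : IsOpen (L : Set (FiniteAdeleRing (𝓞 K) K)))
    (hLc : IsCompact (L : Set (FiniteAdeleRing (𝓞 K) K)))
    (hinv : ∀ (x : InfiniteAdeleRing K) (y : FiniteAdeleRing (𝓞 K) K), ∀ δ ∈ L, f (x, y + δ) = f (x, y))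
    (hsm : ∀ y : FiniteAdeleRing (𝓞 K) K,
      ContDiff ℝ ∞ fun x : mixedSpace K => f ((InfiniteAdeleRing.ringEquiv_mixedSpace K).symm x, y))
    (hcs : ∀ y : FiniteAdeleRing (𝓞 K) K,
      HasCompactSupport fun x : mixedSpace K => f ((InfiniteAdeleRing.ringEquiv_mixedSpace K).symm x, y)) :
    f ∈ Meyer.schwartzBruhatAdele K := by
  rw [Meyer.mem_schwartzBruhatAdele_iff]
  -- transport `C` and `L` along `(Fin 1 → X) ≃ X`
  set e := Homeomorph.funUnique (Fin 1) (FiniteAdeleRing (𝓞 K) K) with he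
  have hCc' : IsCompact (e ⁻¹' C) := by
    rw [← e.image_symm]
    exact hCc.image e.symm.continuous
  set L' : AddSubgroup (Fin 1 → FiniteAdeleRing (𝓞 K) K) := L.comap (Pi.evalAddMonoidHom (fun _ => FiniteAdeleRing (𝓞 K) K) 0)
    with hL'
  have hL'set : (L' : Set (Fin 1 → FiniteAdeleRing (𝓞 K) K)) = e ⁻¹' (L : Set (FiniteAdeleRing (𝓞 K) K)) := rfl
  have hLo' : IsOpen (L' : Set (Fin 1 → FiniteAdeleRing (𝓞 K) K)) := by
    rw [hL'set]; exact hLo.preimage e.continuous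
  have hLc' : IsCompact (L' : Set (Fin 1 → FiniteAdeleRing (𝓞 K) K)) := by
    rw [hL'set, ← e.image_symm]; exact hLc.image e.symm.continuous
  refine mem_piSchwartzBruhat_of_level hCc' (fun v hv => hsupp (v 0) hv) hLo' hLc' (fun x y δ hδ => ?_) (fun y => ?_) (fun y => ?_)
  · show f ((InfiniteAdeleRing.ringEquiv_mixedSpace K).symm (x 0), (y + δ) 0) =
      f ((InfiniteAdeleRing.ringEquiv_mixedSpace K).symm (x 0), y 0)
    rw [Pi.add_apply]
    exact hinv _ _ _ hδ
  · exact (hsm (y 0)).comp (contDiff_apply ℝ (mixedSpace K) (0 : Fin 1))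
  · exact (hcs (y 0)).comp_homeomorph (Homeomorph.funUnique (Fin 1) (mixedSpace K))

end OneVariable

end Literature.NumberTheory.Automorphic
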